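import Mathlib
import HarnessLib
import Summits.ValiantsHypothesis.ValiantsHypothesis.Theses.MonotoneRestoration
import Literature.Computability.AlgebraicComplexity.SupportSymmetrisationEval

/-!
# S3 — support symmetrisation (coset-block symmetrisation), crux `MonotoneRestorationQP`

Stub `stub_supportSymmetrisation` of line `Sketch` of crux item `stmt-ValiantsHypothesis-15886`
(`Summit.ValiantsHypothesis.ValiantsHypothesis.Theses.MonotoneRestoration.MonotoneRestorationQP`):
a well-formed straight-line program over `ℂ` on the `n × n` variable matrix with non-nullary
gates of fan-in `≤ A`, supports `K i` of size `≤ k`, product gates with operands supported inside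
`K i`, gate values invariant under the pointwise stabiliser of `K i` (diagonal action) and an
output gate of empty support is computed by a square-symmetric `LabelledArithCircuit` of size
`≤ 3 (size + 1)(2A + 1)(n + 1)^(k + 2)`.

This is the specialisation to `ℂ` of the Literature theorem
`Literature.Computability.AlgebraicComplexity.SupportSymm.exists_symmetric_circuit_of_supports`
(files `SupportSymmetrisation.lean`, `SupportSymmetrisationEval.lean`: one copy `[i, κ]` of gate
`i` per injection `κ : K i ↪ Fin n`, sum operands re-wired over their compatible coset blocks
with the averaging constants `(n - |K i ∪ supp u|)! / (n - |K i|)!`). The counting hypothesis of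
the registered signature (the statement of the neighbouring stub `stub_cosetCount`) is not
needed: the Literature proof counts coset blocks with
`Literature.Combinatorics.Enumerative.card_permsPrescribed`.
-/

-- `ValiantsHypothesis.ValiantsHypothesis`: the D-0017 layout repeats the problem name in the path.
set_option linter.dupNamespace false

namespace Summit.ValiantsHypothesis.ValiantsHypothesis.Theorems

open Literature.Computability.AlgebraicComplexity

/-- **S3 — coset-block symmetrisation (card A, lever A1).** A well-formed `ArithCircuit` over `ℂ`
on the `n × n` variable matrix, every gate non-nullary with fan-in `≤ A`, annotated with supports
`K i` (`|K i| ≤ k`; product gates take only operands supported inside `K i`; the value of gate `i`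
is invariant under every permutation fixing `K i` pointwise, acting diagonally; the output is a
gate with empty support) is computed by a square-symmetric `LabelledArithCircuit` over `ℂ` of size
`≤ 3 (size + 1)(2A + 1)(n + 1)^(k + 2)` — gates `[i, κ]` for `κ : K i ↪ Fin n`, each sum operand
re-wired over its whole compatible coset block with the averaging constant
`(n - |K i ∪ K j|)!/(n - |K i|)!`. The counting hypothesis (= stub `stub_cosetCount`) is part of
the registered signature but unused (the blocks are counted by `card_permsPrescribed`).
Specialisation of `SupportSymm.exists_symmetric_circuit_of_supports` (Dawar–Pago–Seppelt 2025,
§5, converse direction of the support theorem). [cite: DawarPagoSeppelt2025, §5] -/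
theorem stub_supportSymmetrisation : ∀ (n k A : ℕ) (P : ArithCircuit ℂ (Fin n × Fin n))
    (K : ℕ → Finset (Fin n)),
    (∀ g ∈ P.gates, g.args ≠ []) → (∀ g ∈ P.gates, g.fanIn ≤ A) → P.WellFormed →
    (∀ i, (K i).card ≤ k) →
    (∀ (i : ℕ) (us : List (ArithCircuit.Operand ℂ (Fin n × Fin n))),
      P.gates[i]? = some (.prod us) → ∀ u ∈ us,
        match u with
        | .var pq => pq.1 ∈ K i ∧ pq.2 ∈ K i
        | .const _ => True
        | .gate j => K j ⊆ K i) →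
    (∀ (i : ℕ) (σ : Equiv.Perm (Fin n)), i < P.size → (∀ x ∈ K i, σ x = x) →
      MvPolynomial.rename (fun pq : Fin n × Fin n => (σ pq.1, σ pq.2))
        ((ArithCircuit.gateValues P.gates).getD i 0) = (ArithCircuit.gateValues P.gates).getD i 0) →
    (∃ j, P.output = .gate j ∧ j < P.size ∧ K j = ∅) →
    (∀ (Ki Kj : Finset (Fin n)) (l : Fin n → Fin n),
      Set.InjOn l ↑Kj → (∀ x ∈ Kj, x ∈ Ki → l x = x) → (∀ x ∈ Kj, x ∉ Ki → l x ∉ Ki) →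
      (Finset.univ.filter (fun σ : Equiv.Perm (Fin n) =>
        (∀ x ∈ Ki, σ x = x) ∧ (∀ x ∈ Kj, σ x = l x))).card = Nat.factorial (n - (Ki ∪ Kj).card)) →
    ∃ (G : Type) (_ : Fintype G) (C : LabelledArithCircuit ℂ (Fin n × Fin n) Unit G),
      C.IsSymmetric (Equiv.Perm (Fin n)) ∧ C.eval (C.output ()) = P.eval ∧
      Fintype.card G ≤ 3 * (P.size + 1) * (2 * A + 1) * (n + 1) ^ (k + 2) := by
  intro n k A P K hne hA hwf hk hprod hinv hout _
  refine SupportSymm.exists_symmetric_circuit_of_supports k A P K hne hA hwf hk ?_ hinv hout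
  intro i us h u hu
  have hu' := hprod i us h u hu
  cases u with
  | var pq =>
    intro x hx
    simp only [SupportSymm.osupp, Finset.mem_insert, Finset.mem_singleton] at hx
    rcases hx with rfl | rfl
    · exact hu'.1
    · exact hu'.2
  | const c => simp [SupportSymm.osupp]
  | gate j => exact hu'

end Summit.ValiantsHypothesis.ValiantsHypothesis.Theorems
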